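import Summits.Ventures.CertifiedManyBodySolver.Downfold.EmeryZoneOrbitalContent
import Mathlib.MeasureTheory.Constructions.BorelSpace.Order
import Mathlib.Topology.Semicontinuity.Defs
import HarnessLib

/-!
# THE ANTIBONDING BAND IS A BOREL FUNCTION ON THE ZONE: upper semicontinuity of the largest cubic root in its
# coefficients ⇒ the exact hole count `n^h = 2(1 − abFilling) = 1 + x` and the partition identity `n_d^h + 2n_p^h = n^h`

Venture CertifiedManyBodySolver, cell `pub/hubbard-downfold` (stage S1; INFLATION-RULES-3to1-B §B.82), seat hubbard-downfold-mod-4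
(technique B, g34); namespace `Summit.Ventures.CertifiedManyBodySolver.Downfold.Emery`. Everything PROVED (0 sorry). WHAT THIS IS NOT: a
statement about any material; `U = 0` one-body kinematics of the σ (d–p_x–p_y + t_pp, t_pp′) model; no number lives here.

`EmeryZoneOrbitalContent` defines the zone-integrated Cu-d / O-p hole contents `dHole`, `pHole` and the hole count `nHole` of the σ
antibonding band as OUTER lower Lebesgue integrals and brackets each one separately (its docstring: «`= 1 + x` … whenever the hole set
is measurable — not used»); `EmeryFermiFilling.abFilling` is the (outer) occupied fraction. This file supplies the missing regularity
and closes the bookkeeping EXACTLY: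

* §1 the largest real root `topRoot` of the monic cubic `ε³ + aε² + bε + d`, as a function of `(a, b, d) ∈ ℝ³`, is UPPER
  SEMICONTINUOUS (`upperSemicontinuous_topRoot3`): above the top root the cubic is positive, on a compact window it is bounded away
  from zero, and the coefficient perturbation is uniformly small there; together with the Cauchy bound no root of a nearby cubic can
  reach the window. (Lower semicontinuity fails in general — a complex pair may turn real far above the old top root — and is not
  needed.) Hence it is Borel (`measurable_topRoot3`).
* §2 ON THE ZONE: `abEnergyK = topRoot ∘ (continuous coefficient map of k)` is upper semicontinuous and Borel
  (`upperSemicontinuous_abEnergyK`, `measurable_abEnergyK`); so are the Cu-d weight `abWeightK` (a rational function of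
  `sin²(k_x/2), sin²(k_y/2), ε_AB(k)`; `measurable_abWeightK`), the hole indicator (`measurable_holeInd`), the hole set and the
  occupied set (`measurableSet_holeSet`, `measurableSet_abOccSet`).
* §3 THE EXACT HOLE COUNT: `volume(occupied) + volume(holes) = π²` on the quadrant (`volume_abOccSet_add_volume_holeSet`) ⇒
  **`nHole ε = 2·(1 − abFilling ε)`** for EVERY parameter value and every `ε` (`nHole_eq_two_mul_one_sub_abFilling`); at the Fermi
  energy of hole doping `x` (`abFilling = (1 − x)/2`) the hole count is EXACTLY `1 + x` (`nHole_eq_one_add_of_abFilling`) — the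
  `U = 0` Luttinger count of the σ model, with no staircase width.
* §4 THE PARTITION IDENTITY: for `Δ, t_pp, t_pp′ ≥ 0` and `ε ≥ 0`, **`dHole ε + pHole ε = nHole ε`** (`dHole_add_pHole`; additivity
  of the Lebesgue integral on the now-measurable integrands `𝟙·w_d`, `𝟙·(1 − w_d) ∈ [0, 1]`) ⇒ `n_d^h + 2n_p^h = 1 + x` exactly
  (`dHole_add_pHole_eq_one_add`), `2n_p^h = 1 + x − n_d^h` (`pHole_eq_of_abFilling`), and between two fillings the DOPED holes are
  partitioned exactly: `(n_d^h(x₂) − n_d^h(x₁)) + (2n_p^h(x₂) − 2n_p^h(x₁)) = x₂ − x₁` (`doped_holes_partition`).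
* §5 READING A CENSUS ROW EXACTLY: a `dHole` bracket `[d₁, d₂]` at filling `(1 − x)/2` gives `pHole ∈ [1 + x − d₂, 1 + x − d₁]` and
  the oxygen SHARE of the holes `pHole/nHole = 1 − dHole/(1 + x) ∈ [1 − d₂/(1 + x), 1 − d₁/(1 + x)]` (`pHole_mem_Icc_of_dHole_mem`,
  `pHole_div_nHole_eq`, `pHole_div_nHole_mem_Icc`) — every row of router/ZONE-PARTITION.tsv is a partition of exactly `1 + x`.

Sources: three-band model [HybertsenSchluterChristensen1989, Eq. (1)]; [AndersenEtAl1995, §6]; semicontinuity of polynomial roots,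
Borel measurability of semicontinuous functions and additivity of the Lebesgue integral [folklore] (e.g. R. E. Moore, Interval
Analysis, 1966 for the enclosure language; any measure-theory text).
-/

noncomputable section

namespace Summit.Ventures.CertifiedManyBodySolver.Downfold.Emery

open Real MeasureTheory Set Filter Topology
open scoped ENNReal

/-! ## §1 Upper semicontinuity of the largest root of a monic cubic in its coefficients -/

/-- Above the top root the monic cubic is positive (contrapositive of `le_topRoot_of_nonpos`). [folklore] -/
theorem monicCubic_pos_of_topRoot_lt {a b d ε : ℝ} (h : topRoot a b d < ε) : 0 < monicCubic a b d ε := by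
  by_contra hle
  push Not at hle
  exact absurd (le_topRoot_of_nonpos hle) (not_le.mpr h)

/-- The coefficient perturbation of the monic cubic at a point `r` with `|r| ≤ R`:
`|p_{a,b,d}(r) − p_{a₀,b₀,d₀}(r)| ≤ |a − a₀|R² + |b − b₀|R + |d − d₀|`. [folklore] -/
theorem abs_monicCubic_sub_le {a b d a₀ b₀ d₀ r R : ℝ} (hr : |r| ≤ R) :
    |monicCubic a b d r - monicCubic a₀ b₀ d₀ r| ≤ |a - a₀| * R ^ 2 + |b - b₀| * R + |d - d₀| := by
  have hdiff : monicCubic a b d r - monicCubic a₀ b₀ d₀ r = (a - a₀) * r ^ 2 + (b - b₀) * r + (d - d₀) := by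
    unfold monicCubic; ring
  rw [hdiff]
  have hR : 0 ≤ R := (abs_nonneg r).trans hr
  have h1 : |(a - a₀) * r ^ 2| ≤ |a - a₀| * R ^ 2 := by
    rw [abs_mul, abs_pow]
    exact mul_le_mul_of_nonneg_left (by nlinarith [abs_nonneg r]) (abs_nonneg _)
  have h2 : |(b - b₀) * r| ≤ |b - b₀| * R := by
    rw [abs_mul]; exact mul_le_mul_of_nonneg_left hr (abs_nonneg _)
  calc |(a - a₀) * r ^ 2 + (b - b₀) * r + (d - d₀)|
      ≤ |(a - a₀) * r ^ 2 + (b - b₀) * r| + |d - d₀| := abs_add_le _ _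
    _ ≤ |(a - a₀) * r ^ 2| + |(b - b₀) * r| + |d - d₀| := by
        have := abs_add_le ((a - a₀) * r ^ 2) ((b - b₀) * r); linarith
    _ ≤ |a - a₀| * R ^ 2 + |b - b₀| * R + |d - d₀| := by linarith

/-- **THE LARGEST ROOT OF A MONIC CUBIC IS UPPER SEMICONTINUOUS IN THE COEFFICIENTS.** If `topRoot(a₀, b₀, d₀) < μ` then
`topRoot(a, b, d) < μ` for all `(a, b, d)` near `(a₀, b₀, d₀)`: on the window `[μ, M₀]` (`M₀ = 1 +` the Cauchy bound at the
centre) the centre cubic is `≥ δ > 0`, the perturbation is eventually `< δ` there, and beyond its own Cauchy bound (eventually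
`< M₀`) every cubic is positive — so a nearby cubic has no root `≥ μ`. [folklore] -/
theorem upperSemicontinuous_topRoot3 : UpperSemicontinuous fun p : ℝ × ℝ × ℝ => topRoot p.1 p.2.1 p.2.2 := by
  refine upperSemicontinuous_iff.mpr fun c₀ => upperSemicontinuousAt_iff.mpr fun μ hμ => ?_
  obtain ⟨a₀, b₀, d₀⟩ := c₀
  simp only at hμ ⊢
  set M₀ : ℝ := cubicBound a₀ b₀ d₀ + 1 with hM₀
  have hcb : Continuous fun c : ℝ × ℝ × ℝ => cubicBound c.1 c.2.1 c.2.2 := by unfold cubicBound; fun_prop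
  have ev1 : ∀ᶠ c : ℝ × ℝ × ℝ in 𝓝 (a₀, b₀, d₀), cubicBound c.1 c.2.1 c.2.2 < M₀ :=
    (hcb.continuousAt (x := (a₀, b₀, d₀))).eventually_lt continuousAt_const (by simp only [hM₀]; linarith)
  by_cases hμM : M₀ ≤ μ
  · filter_upwards [ev1] with c hc
    have hlt := lt_cubicBound_of_root (monicCubic_topRoot c.1 c.2.1 c.2.2)
    linarith
  push Not at hμM
  -- the window `[μ, M₀]` is nonempty and compact; the centre cubic is positive there, hence `≥ δ > 0`
  obtain ⟨ε₀, hε₀S, hmin⟩ := (isCompact_Icc : IsCompact (Icc μ M₀)).exists_isMinOn (nonempty_Icc.mpr hμM.le)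
    (continuous_monicCubic a₀ b₀ d₀).continuousOn
  set δ : ℝ := monicCubic a₀ b₀ d₀ ε₀ with hδ
  have hδpos : 0 < δ := monicCubic_pos_of_topRoot_lt (lt_of_lt_of_le hμ hε₀S.1)
  set R : ℝ := |μ| + |M₀| + 1 with hR
  have hL : Continuous fun c : ℝ × ℝ × ℝ => |c.1 - a₀| * R ^ 2 + |c.2.1 - b₀| * R + |c.2.2 - d₀| := by fun_prop
  have ev2 : ∀ᶠ c : ℝ × ℝ × ℝ in 𝓝 (a₀, b₀, d₀), |c.1 - a₀| * R ^ 2 + |c.2.1 - b₀| * R + |c.2.2 - d₀| < δ :=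
    (hL.continuousAt (x := (a₀, b₀, d₀))).eventually_lt continuousAt_const (by simpa using hδpos)
  filter_upwards [ev1, ev2] with c hc1 hc2
  obtain ⟨a, b, d⟩ := c
  simp only at hc1 hc2 ⊢
  by_contra hge
  push Not at hge
  have hroot := monicCubic_topRoot a b d
  have hrM : topRoot a b d < M₀ := by have := lt_cubicBound_of_root hroot; linarith
  have hp0 : δ ≤ monicCubic a₀ b₀ d₀ (topRoot a b d) := by
    have := hmin (a := topRoot a b d) ⟨hge, hrM.le⟩
    simpa [hδ] using this
  have hrabs : |topRoot a b d| ≤ R := by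
    have hμabs := neg_abs_le μ
    have hMabs := le_abs_self M₀
    have hμnn := abs_nonneg μ
    have hMnn := abs_nonneg M₀
    rcases le_or_gt 0 (topRoot a b d) with h | h
    · rw [abs_of_nonneg h]; linarith
    · rw [abs_of_neg h]; linarith
  have hbd := abs_monicCubic_sub_le (a := a) (b := b) (d := d) (a₀ := a₀) (b₀ := b₀) (d₀ := d₀) hrabs
  have hlo := (abs_le.mp hbd).1
  linarith

/-- Hence the largest root is a BOREL function of the coefficients. [folklore] -/
theorem measurable_topRoot3 : Measurable fun p : ℝ × ℝ × ℝ => topRoot p.1 p.2.1 p.2.2 :=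
  upperSemicontinuous_topRoot3.measurable

/-! ## §2 On the zone: the antibonding band, its Cu weight, the hole indicator and the hole / occupied sets are Borel -/

section Zone

variable {Δ a b c : ℝ}

/-- `k ↦ sin²(k/2)` is continuous. [folklore] -/
theorem continuous_halfSq : Continuous halfSq := by unfold halfSq; fun_prop

/-- The coefficient triple `(cubA, cubB, cubD)` of the σ characteristic cubic is continuous on the zone. [folklore] -/
theorem continuous_cubicCoeffK (Δ a b c : ℝ) : Continuous fun k : ℝ × ℝ =>
    (cubA Δ c (halfSq k.1) (halfSq k.2), cubB Δ a b c (halfSq k.1) (halfSq k.2), cubD Δ a b c (halfSq k.1) (halfSq k.2)) := by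
  have h1 : Continuous fun k : ℝ × ℝ => halfSq k.1 := continuous_halfSq.comp continuous_fst
  have h2 : Continuous fun k : ℝ × ℝ => halfSq k.2 := continuous_halfSq.comp continuous_snd
  unfold cubA cubB cubD
  fun_prop

/-- `ε_AB(k) = topRoot(coefficients at k)` as a composition. [folklore] -/
theorem abEnergyK_eq_comp (Δ a b c : ℝ) : abEnergyK Δ a b c = (fun p : ℝ × ℝ × ℝ => topRoot p.1 p.2.1 p.2.2) ∘ fun k : ℝ × ℝ =>
    (cubA Δ c (halfSq k.1) (halfSq k.2), cubB Δ a b c (halfSq k.1) (halfSq k.2), cubD Δ a b c (halfSq k.1) (halfSq k.2)) := by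
  funext k; rfl

/-- **THE ANTIBONDING BAND IS UPPER SEMICONTINUOUS ON THE ZONE.** [folklore] -/
theorem upperSemicontinuous_abEnergyK (Δ a b c : ℝ) : UpperSemicontinuous (abEnergyK Δ a b c) := by
  rw [abEnergyK_eq_comp]
  exact upperSemicontinuous_topRoot3.comp (continuous_cubicCoeffK Δ a b c)

/-- **THE ANTIBONDING BAND IS A BOREL FUNCTION ON THE ZONE** (every parameter value). [folklore] -/
theorem measurable_abEnergyK (Δ a b c : ℝ) : Measurable (abEnergyK Δ a b c) :=
  (upperSemicontinuous_abEnergyK Δ a b c).measurable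

/-- The hole set `{k | ε < ε_AB(k)}` is Borel. [folklore] -/
theorem measurableSet_holeSet (Δ a b c ε : ℝ) : MeasurableSet {k : ℝ × ℝ | ε < abEnergyK Δ a b c k} :=
  measurableSet_lt measurable_const (measurable_abEnergyK Δ a b c)

/-- The sub-level set `{k | ε_AB(k) ≤ ε}` is Borel. [folklore] -/
theorem measurableSet_subLevel (Δ a b c ε : ℝ) : MeasurableSet {k : ℝ × ℝ | abEnergyK Δ a b c k ≤ ε} :=
  measurableSet_le (measurable_abEnergyK Δ a b c) measurable_const

/-- The hole indicator is Borel. [folklore] -/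
theorem measurable_holeInd (Δ a b c ε : ℝ) : Measurable (holeInd Δ a b c ε) := by
  unfold holeInd
  exact Measurable.ite (measurableSet_holeSet Δ a b c ε) measurable_const measurable_const

/-- The Cu-d weight as a function of `(x, y, ε)` is a rational function, hence Borel on `ℝ³`. [folklore] -/
theorem measurable_dWeight3 (Δ a b c : ℝ) : Measurable fun p : ℝ × ℝ × ℝ => dWeight Δ a b c p.1 p.2.1 p.2.2 := by
  have hnum : Continuous fun p : ℝ × ℝ × ℝ => minorD Δ b c p.1 p.2.1 p.2.2 := by unfold minorD; fun_prop
  have hden : Continuous fun p : ℝ × ℝ × ℝ =>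
      minorD Δ b c p.1 p.2.1 p.2.2 + minorX Δ a c p.2.1 p.2.2 + minorY Δ a c p.1 p.2.2 := by
    unfold minorD minorX minorY; fun_prop
  unfold dWeight
  exact hnum.measurable.div hden.measurable

/-- `w_d(k) = dWeight(sin²(k_x/2), sin²(k_y/2), ε_AB(k))` as a composition. [folklore] -/
theorem abWeightK_eq_comp (Δ a b c : ℝ) :
    abWeightK Δ a b c = (fun p : ℝ × ℝ × ℝ => dWeight Δ a b c p.1 p.2.1 p.2.2) ∘
      fun k => (halfSq k.1, halfSq k.2, abEnergyK Δ a b c k) := by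
  funext k; rfl

/-- **THE Cu-d WEIGHT OF THE ANTIBONDING BLOCH STATE IS A BOREL FUNCTION ON THE ZONE.** [folklore] -/
theorem measurable_abWeightK (Δ a b c : ℝ) : Measurable (abWeightK Δ a b c) := by
  rw [abWeightK_eq_comp]
  refine (measurable_dWeight3 Δ a b c).comp ?_
  exact (continuous_halfSq.measurable.comp measurable_fst).prodMk
    ((continuous_halfSq.measurable.comp measurable_snd).prodMk (measurable_abEnergyK Δ a b c))

/-- The `d` integrand `𝟙[ε < ε_AB]·w_d` is Borel. [folklore] -/
theorem measurable_dIntegrand (Δ a b c ε : ℝ) : Measurable fun k => holeInd Δ a b c ε k * abWeightK Δ a b c k :=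
  (measurable_holeInd Δ a b c ε).mul (measurable_abWeightK Δ a b c)

/-- The `p` integrand `𝟙[ε < ε_AB]·(1 − w_d)` is Borel. [folklore] -/
theorem measurable_pIntegrand (Δ a b c ε : ℝ) :
    Measurable fun k => holeInd Δ a b c ε k * (1 - abWeightK Δ a b c k) :=
  (measurable_holeInd Δ a b c ε).mul (measurable_const.sub (measurable_abWeightK Δ a b c))

/-- The occupied set of `EmeryFermiFilling` is the quadrant cut by the sub-level set of `ε_AB`. [folklore] -/
theorem abOccSet_eq (Δ a b c ε : ℝ) : abOccSet Δ a b c ε = bzQuad ∩ {k | abEnergyK Δ a b c k ≤ ε} := by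
  ext k; exact Iff.rfl

/-- **THE OCCUPIED SET IS BOREL** (so `abFilling` is a genuine Lebesgue fraction, not only an outer one). [folklore] -/
theorem measurableSet_abOccSet (Δ a b c ε : ℝ) : MeasurableSet (abOccSet Δ a b c ε) := by
  rw [abOccSet_eq]; exact measurableSet_bzQuad.inter (measurableSet_subLevel Δ a b c ε)

/-! ## §3 The exact hole count `n^h = 2(1 − abFilling) = 1 + x` -/

/-- The zone integral of the hole indicator is the measure of the hole part of the quadrant. [folklore] -/
theorem zoneLint_holeInd_eq (Δ a b c ε : ℝ) :
    zoneLint (holeInd Δ a b c ε) = volume (bzQuad ∩ {k | ε < abEnergyK Δ a b c k}) := by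
  unfold zoneLint
  have hfun : (fun k => ENNReal.ofReal (holeInd Δ a b c ε k)) = {k : ℝ × ℝ | ε < abEnergyK Δ a b c k}.indicator 1 := by
    funext k
    unfold holeInd
    by_cases h : ε < abEnergyK Δ a b c k
    · rw [if_pos h, indicator_of_mem (show k ∈ {k : ℝ × ℝ | ε < abEnergyK Δ a b c k} from h)]
      simp
    · rw [if_neg h, indicator_of_notMem (show k ∉ {k : ℝ × ℝ | ε < abEnergyK Δ a b c k} from h)]
      simp
  rw [hfun, lintegral_indicator_one (measurableSet_holeSet Δ a b c ε),
    Measure.restrict_apply (measurableSet_holeSet Δ a b c ε), inter_comm]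

/-- `volume(occupied part) + volume(hole part) = volume(quadrant)`. [folklore] -/
theorem volume_abOccSet_add_volume_holeSet (Δ a b c ε : ℝ) :
    volume (abOccSet Δ a b c ε) + volume (bzQuad ∩ {k | ε < abEnergyK Δ a b c k}) = volume bzQuad := by
  rw [abOccSet_eq]
  have h := measure_inter_add_sdiff (μ := volume) bzQuad (measurableSet_subLevel Δ a b c ε)
  have hdiff : bzQuad \ {k : ℝ × ℝ | abEnergyK Δ a b c k ≤ ε} = bzQuad ∩ {k | ε < abEnergyK Δ a b c k} := by
    ext k; simp only [Set.mem_sdiff, mem_inter_iff, mem_setOf_eq, not_le]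
  rwa [hdiff] at h

/-- `vol(Q) = π²` as a real number. [folklore] -/
theorem volume_bzQuad_toReal : (volume bzQuad).toReal = π ^ 2 := by
  rw [volume_bzQuad, ENNReal.toReal_mul, ENNReal.toReal_ofReal (by linarith [pi_pos])]; ring

/-- [folklore] -/
theorem volume_holeSet_ne_top (Δ a b c ε : ℝ) : volume (bzQuad ∩ {k | ε < abEnergyK Δ a b c k}) ≠ ⊤ :=
  ne_top_of_le_ne_top volume_bzQuad_ne_top (measure_mono inter_subset_left)

/-- **THE EXACT HOLE COUNT: `nHole ε = 2·(1 − abFilling ε)`** for every parameter value and every Fermi energy — the outer hole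
count of `EmeryZoneOrbitalContent` is `2 × (1 −` the occupied fraction of `EmeryFermiFilling)`. [folklore] -/
theorem nHole_eq_two_mul_one_sub_abFilling (Δ a b c ε : ℝ) : nHole Δ a b c ε = 2 * (1 - abFilling Δ a b c ε) := by
  have h := congrArg ENNReal.toReal (volume_abOccSet_add_volume_holeSet Δ a b c ε)
  rw [ENNReal.toReal_add (volume_abOccSet_ne_top Δ a b c ε) (volume_holeSet_ne_top Δ a b c ε), volume_bzQuad_toReal] at h
  unfold nHole abFilling
  rw [zoneLint_holeInd_eq]
  have hπ : (0 : ℝ) < π ^ 2 := by positivity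
  field_simp
  linarith

/-- **AT HOLE DOPING `x` THE HOLE COUNT IS EXACTLY `1 + x`** (`abFilling(ε_F) = (1 − x)/2`; the `U = 0` Luttinger count of the
σ model). [folklore] -/
theorem nHole_eq_one_add_of_abFilling {Δ a b c ε x : ℝ} (h : abFilling Δ a b c ε = (1 - x) / 2) :
    nHole Δ a b c ε = 1 + x := by
  rw [nHole_eq_two_mul_one_sub_abFilling, h]; ring

/-- Degenerate-interval form of the filling hypothesis used by the census files (`abFilling ∈ [ν, ν]`). [folklore] -/
theorem nHole_eq_of_abFilling_mem {Δ a b c ε ν : ℝ} (h : abFilling Δ a b c ε ∈ Icc ν ν) :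
    nHole Δ a b c ε = 2 - 2 * ν := by
  rw [nHole_eq_two_mul_one_sub_abFilling, show abFilling Δ a b c ε = ν from le_antisymm h.2 h.1]; ring

/-! ## §4 The partition identity `n_d^h + 2n_p^h = n^h` -/

section Partition

variable {Δ a b c : ℝ}

/-- **THE PARTITION IDENTITY `dHole ε + pHole ε = nHole ε`** (`Δ, t_pp′, t_pp ≥ 0`, `ε ≥ 0`: on the hole set the band energy is
positive, so `w_d ∈ [0, 1]` and the two integrands add up to the hole indicator; additivity of the Lebesgue integral on Borel
integrands). [folklore] -/
theorem dHole_add_pHole (hΔ : 0 ≤ Δ) (hc : 0 ≤ c) (hb : 0 ≤ b) {ε : ℝ} (hε : 0 ≤ ε) :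
    dHole Δ a b c ε + pHole Δ a b c ε = nHole Δ a b c ε := by
  have hd := fun k => dIntegrand_mem (a := a) hΔ hc hb hε k
  have hp := fun k => pIntegrand_mem (a := a) hΔ hc hb hε k
  unfold dHole pHole nHole
  rw [← mul_add, ← ENNReal.toReal_add (zoneLint_ne_top fun k => (hd k).2) (zoneLint_ne_top fun k => (hp k).2)]
  congr 2
  unfold zoneLint
  rw [← lintegral_add_left (measurable_dIntegrand Δ a b c ε).ennreal_ofReal]
  refine lintegral_congr fun k => ?_
  rw [← ENNReal.ofReal_add (hd k).1 (hp k).1]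
  congr 1; ring

/-- **`n_d^h + 2n_p^h = 1 + x` EXACTLY at hole doping `x`.** [folklore] -/
theorem dHole_add_pHole_eq_one_add (hΔ : 0 ≤ Δ) (hc : 0 ≤ c) (hb : 0 ≤ b) {ε x : ℝ} (hε : 0 ≤ ε)
    (h : abFilling Δ a b c ε = (1 - x) / 2) : dHole Δ a b c ε + pHole Δ a b c ε = 1 + x := by
  rw [dHole_add_pHole hΔ hc hb hε, nHole_eq_one_add_of_abFilling h]

/-- **`2n_p^h = 1 + x − n_d^h`.** [folklore] -/
theorem pHole_eq_of_abFilling (hΔ : 0 ≤ Δ) (hc : 0 ≤ c) (hb : 0 ≤ b) {ε x : ℝ} (hε : 0 ≤ ε)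
    (h : abFilling Δ a b c ε = (1 - x) / 2) : pHole Δ a b c ε = 1 + x - dHole Δ a b c ε := by
  have := dHole_add_pHole_eq_one_add hΔ hc hb hε h; linarith

/-- **THE DOPED HOLES ARE PARTITIONED EXACTLY**: between hole dopings `x₁` and `x₂`,
`Δn_d^h + Δ(2n_p^h) = x₂ − x₁`. [folklore] -/
theorem doped_holes_partition (hΔ : 0 ≤ Δ) (hc : 0 ≤ c) (hb : 0 ≤ b) {ε₁ ε₂ x₁ x₂ : ℝ} (hε₁ : 0 ≤ ε₁) (hε₂ : 0 ≤ ε₂)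
    (h₁ : abFilling Δ a b c ε₁ = (1 - x₁) / 2) (h₂ : abFilling Δ a b c ε₂ = (1 - x₂) / 2) :
    (dHole Δ a b c ε₂ - dHole Δ a b c ε₁) + (pHole Δ a b c ε₂ - pHole Δ a b c ε₁) = x₂ - x₁ := by
  have e1 := dHole_add_pHole_eq_one_add hΔ hc hb hε₁ h₁
  have e2 := dHole_add_pHole_eq_one_add hΔ hc hb hε₂ h₂
  linarith

/-! ## §5 Reading a census row exactly -/

/-- A `dHole` bracket gives a `pHole` bracket through the identity. [folklore] -/
theorem pHole_mem_Icc_of_dHole_mem (hΔ : 0 ≤ Δ) (hc : 0 ≤ c) (hb : 0 ≤ b) {ε x d₁ d₂ : ℝ} (hε : 0 ≤ ε)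
    (h : abFilling Δ a b c ε = (1 - x) / 2) (hd : dHole Δ a b c ε ∈ Icc d₁ d₂) :
    pHole Δ a b c ε ∈ Icc (1 + x - d₂) (1 + x - d₁) := by
  rw [pHole_eq_of_abFilling hΔ hc hb hε h]
  exact ⟨by linarith [hd.2], by linarith [hd.1]⟩

/-- **THE OXYGEN SHARE OF THE HOLES** `2n_p^h/n^h = 1 − n_d^h/(1 + x)` (exact denominator). [folklore] -/
theorem pHole_div_nHole_eq (hΔ : 0 ≤ Δ) (hc : 0 ≤ c) (hb : 0 ≤ b) {ε x : ℝ} (hε : 0 ≤ ε) (hx : 0 < 1 + x)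
    (h : abFilling Δ a b c ε = (1 - x) / 2) :
    pHole Δ a b c ε / nHole Δ a b c ε = 1 - dHole Δ a b c ε / (1 + x) := by
  rw [pHole_eq_of_abFilling hΔ hc hb hε h, nHole_eq_one_add_of_abFilling h]
  field_simp

/-- Oxygen share bracket from a `dHole` bracket. [folklore] -/
theorem pHole_div_nHole_mem_Icc (hΔ : 0 ≤ Δ) (hc : 0 ≤ c) (hb : 0 ≤ b) {ε x d₁ d₂ : ℝ} (hε : 0 ≤ ε) (hx : 0 < 1 + x)
    (h : abFilling Δ a b c ε = (1 - x) / 2) (hd : dHole Δ a b c ε ∈ Icc d₁ d₂) :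
    pHole Δ a b c ε / nHole Δ a b c ε ∈ Icc (1 - d₂ / (1 + x)) (1 - d₁ / (1 + x)) := by
  rw [pHole_div_nHole_eq hΔ hc hb hε hx h]
  constructor
  · have := div_le_div_of_nonneg_right hd.2 hx.le; linarith
  · have := div_le_div_of_nonneg_right hd.1 hx.le; linarith

/-- The Cu share of the holes `n_d^h/n^h = n_d^h/(1 + x)`. [folklore] -/
theorem dHole_div_nHole_eq {ε x : ℝ} (h : abFilling Δ a b c ε = (1 - x) / 2) :
    dHole Δ a b c ε / nHole Δ a b c ε = dHole Δ a b c ε / (1 + x) := by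
  rw [nHole_eq_one_add_of_abFilling h]

end Partition

end Zone

end Summit.Ventures.CertifiedManyBodySolver.Downfold.Emery
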